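import Summits.Parity.GeneralizedHardyLittlewood.Theses.LeeYangFibres
import HarnessLib

/-!
# Route `LeeYangFibres`, crux `CellParityLaw` (stmt-Parity-14109): vocabulary of the line `section-annihilator`

Route-posited objects (D-0016 `<Route><Crux>Defs` file) shared by the registered stubs of the skeleton
`Cruxes/CellParityLaw/Lines/section-annihilator.lean` (line lead `prover-line-stmt-Parity-14109-0`) and by the
crux file that composes them. NOTHING IS ASSERTED: every `def … : Prop` below is a *statement* — the type of a
registered stub (`stub_sectionLevel`, `stub_sectionBombieri`, `stub_modelDensityBounds`, `stub_singularRatio`,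
`stub_walshStep`, `stub_base`, `stub_compose`) or an induction hypothesis — consumed only as the type of a stub
theorem or as an explicit hypothesis. The objects `cell`, `modelDensity`, `walsh` are VERBATIM the inlined finsets /
Walsh factor of the route decl `LeeYangFibres.CellParityLaw`; `zeroCount`, `sectionDensity`, `sectionMass` are the
section (fibre) data of the line.

The line (card `Cruxes/CellParityLaw/Lines/section-annihilator.md`): the joint rough `Ω`-cell tensor `C_j`,
`j ∈ [1,u]^{t+1}`, of a `(t+1)`-form system obeys the parity-vector (Walsh) law iff every coordinate SECTION
`m ↦ C_{(m,j')}` is parity-affine in the model basis; each section is ONE sifted sequence, to which Bombieri's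
asymptotic sieve applies once its level of distribution is granted (`SectionLevelAt`, the conjectural atom ⟹
`SectionLawAt`, the engine's output); the Walsh amplitudes are assembled coordinate by coordinate
(`WalshStep`), by induction on the number of forms from one progression segment (`LawEffAt 1`), with EFFECTIVE
budgets `N/(log^t N (log log N)^B)` between the layers (the crux's absolute `ε N/log^t N` demands relative accuracy
`(log log N)^{-O(t)}` on systems with large singular product). The registered bookkeeping stub `stub_compose` (pure
logic in the six other stub STATEMENTS: induction on `t`) is proved at the end; through it this vocabulary file lands
as a `--supports` file of stmt-Parity-14109 (precedent: `LeeYangFibresModelHyperbolicityDefs.lean` / `stub_glue`).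

References: Bombieri, *The asymptotic sieve*, Rend. Accad. Naz. XL (1976) [BombieriAsymptoticSieve1976]; Bombieri,
RIMS Kokyuroku (1977) pp. 3–6 [BombieriRIMS1977]; Friedlander–Iwaniec, Ann. Sc. Norm. Pisa (1978) §4
[FriedlanderIwaniecPisa1978]; Green–Tao, Ann. of Math. 171 (2010) Conj. 1.4 [GreenTao2010].
-/

noncomputable section

open scoped BigOperators Classical
open Finset Literature.NumberTheory.Sieve

namespace Summit.Parity.GeneralizedHardyLittlewood.Cruxes.CellParityLaw.SectionAnnihilator

/-! ## Objects (the crux's own inlined objects; nothing new is posited) -/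

/-- The joint rough `Ω`-cell count `C_j(Ψ, K, N, u)` — VERBATIM the filtered count of
`LeeYangFibres.CellParityLaw`: lattice points `n ∈ [-N,N] ∩ K` with `P⁻(ψ_i(n)) > N^{1/u}` and
`Ω(ψ_i(n)) = j_i` for every form. -/
def cell {t : ℕ} (Ψ : Fin t → AffLinForm 1) (K : Set (Fin 1 → ℝ)) (N u : ℕ) (j : Fin t → ℕ) : ℕ :=
  ((latticeBox 1 N).filter (fun n => realPoint n ∈ K ∧ ∀ i,
      (N : ℝ) ^ ((1 : ℝ) / u) < (Nat.minFac ((Ψ i).eval n).toNat : ℝ) ∧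
        ArithmeticFunction.cardFactors ((Ψ i).eval n).toNat = j i)).card

/-- The model cell density `a_m = A_m(N)/N`, `A_m(N) = #{n ≤ N : P⁻(n) > N^{1/u}, Ω(n) = m}` —
VERBATIM the crux's model factor (`a_m = 0` for `m ≥ u`: a product of `u` primes `> N^{1/u}` exceeds `N`). -/
def modelDensity (N u m : ℕ) : ℝ :=
  ((((Finset.Icc 1 N).filter (fun n => (N : ℝ) ^ ((1 : ℝ) / u) < (Nat.minFac n : ℝ) ∧
      ArithmeticFunction.cardFactors n = m)).card : ℕ) : ℝ) / N

/-- The Walsh polynomial `W_θ(j) = ∑_S θ_S ∏_{i ∈ S} (-1)^{j_i + 1}` of the parity vector of `j` —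
VERBATIM the crux's amplitude factor. -/
def walsh {t : ℕ} (θ : Finset (Fin t) → ℝ) (j : Fin t → ℕ) : ℝ :=
  ∑ S : Finset (Fin t), θ S * ∏ i ∈ S, (-1 : ℝ) ^ (j i + 1)

/-- `ν_p(Ψ)`: the number of residues `c mod p` at which some form of the (one-dimensional)
system vanishes mod `p` (so `β_p(Ψ) = (1 - ν_p/p)(1 - 1/p)^{-t}` is the tree's `localFactor Ψ p`). -/
def zeroCount {s : ℕ} (Ψ : Fin s → AffLinForm 1) (p : ℕ) : ℕ :=
  ((Finset.range p).filter (fun c => ∃ k, (p : ℤ) ∣ (Ψ k).eval (fun _ => (c : ℤ)))).card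

/-- The SECTION DENSITY `g_{Ψ,i}(d) = ∏_{p ∣ d} g_{Ψ,i}(p)` (used on square-free `d`), with
`g_{Ψ,i}(p) = (ν_p(Ψ) - ν_p(Ψ₋ᵢ)) / (p - ν_p(Ψ₋ᵢ))`, `Ψ₋ᵢ = Fin.removeNth i Ψ`: the proportion,
among the residues `n mod p` allowed by `p ∤ ψ_k(n)` (`k ≠ i`), of those with `p ∣ ψ_i(n)`.
It is the exact telescoping factor of the singular series,
`(1 - g_{Ψ,i}(p)) · β_p(Ψ₋ᵢ) = (1 - 1/p) · β_p(Ψ)`; junk `x/0 = 0` only when `ν_p(Ψ₋ᵢ) = p`, where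
every section is empty. -/
def sectionDensity {t : ℕ} (Ψ : Fin (t + 1) → AffLinForm 1) (i : Fin (t + 1)) (d : ℕ) : ℝ :=
  ∏ p ∈ d.primeFactors,
    ((zeroCount Ψ p : ℝ) - zeroCount (Fin.removeNth i Ψ) p) / ((p : ℝ) - zeroCount (Fin.removeNth i Ψ) p)

/-- The SECTION (fibre) MASS in the class `0 mod d`: lattice points `n ∈ [-N,N] ∩ K` with
`ψ_i(n) > 0`, `d ∣ ψ_i(n)`, and every OTHER form in its cell `j'_k` (`k : Fin t` indexes the
forms `ψ_{i.succAbove k}`). `d = 1` is the total mass `F⁽ⁱ⁾_{j'}` of the section sequence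
`b(m) = #{n : ψ_i(n) = m, others in cells}`; it equals the joint cell count of the `t`-form
subsystem `Fin.removeNth i Ψ` over the convex half-body `K ∩ {ψ_i > 0}`. -/
def sectionMass {t : ℕ} (Ψ : Fin (t + 1) → AffLinForm 1) (K : Set (Fin 1 → ℝ)) (N u : ℕ)
    (i : Fin (t + 1)) (j' : Fin t → ℕ) (d : ℕ) : ℕ :=
  ((latticeBox 1 N).filter (fun n => realPoint n ∈ K ∧ 0 < (Ψ i).eval n ∧ (d : ℤ) ∣ (Ψ i).eval n ∧
      ∀ k : Fin t, (N : ℝ) ^ ((1 : ℝ) / u) < (Nat.minFac ((Ψ (i.succAbove k)).eval n).toNat : ℝ) ∧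
        ArithmeticFunction.cardFactors ((Ψ (i.succAbove k)).eval n).toNat = j' k)).card

/-! ## Statements of the line (types of the registered stubs and their hypotheses) -/

/-- **Effective cell-parity law for `t` forms** (`LawEffAt t`): the body of
`LeeYangFibres.CellParityLaw` at a fixed number of forms, with the `ε N / log^t N` budget replaced by
`N / (log^t N · (log log N)^B)` for EVERY `B : ℕ` (the crux follows with `B = 1`, `(log log N)^{-1} ≤ ε`).
The induction hypothesis of the line; type of `stub_base` at `t = 1`. -/
def LawEffAt (t : ℕ) : Prop :=
  ∀ (L u B : ℕ), 2 ≤ u → ∃ N₀ : ℕ, ∀ N : ℕ, N₀ ≤ N →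
    ∀ Ψ : Fin t → AffLinForm 1, IsNondegenerateSystem Ψ → affLinSize Ψ N ≤ L →
    ∀ K : Set (Fin 1 → ℝ), Convex ℝ K → K ⊆ realBox 1 N →
    ∃ θ : Finset (Fin t) → ℝ, θ ∅ = 1 ∧ (∀ S, |θ S| ≤ 2) ∧
      ∀ j : Fin t → ℕ, (∀ i, 1 ≤ j i ∧ j i ≤ u) →
        |(cell Ψ K N u j : ℝ) -
            walsh θ j * (archFactor Ψ K * singularProduct Ψ * ∏ i, modelDensity N u (j i))|
          ≤ (N : ℝ) / (Real.log N ^ t * Real.log (Real.log N) ^ B)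

/-- **The section atom** (`SectionLevelAt t`, systems of `t + 1 ≥ 2` forms; type of `stub_sectionLevel`):
Bombieri's `(A₂)` for every coordinate section sequence, with the explicit rough-supported density
`sectionDensity`, at level `N^{1 - (log log N)^{-B}}` and with saving `(log N)^{-A}`, for all `A, B`,
uniformly over systems of size `≤ L`, convex `K ⊆ [-N,N]`, coordinates `i` and frozen cells `j' ∈ [1,u]^t`.
`t = 1`: an Elliott–Halberstam-type statement (one fixed class per modulus) for shifted rough `Ω`-cells at level
`x^{1-o(1)}`; `t ≥ 2`: relative equidistribution of prime-tuple-type sets — open at every level. The whole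
conjectural input of the line (a statement, not a fact). -/
def SectionLevelAt (t : ℕ) : Prop :=
  ∀ (L u A B : ℕ), 2 ≤ u → ∃ N₀ : ℕ, ∀ N : ℕ, N₀ ≤ N →
    ∀ Ψ : Fin (t + 1) → AffLinForm 1, IsNondegenerateSystem Ψ → affLinSize Ψ N ≤ L →
    ∀ K : Set (Fin 1 → ℝ), Convex ℝ K → K ⊆ realBox 1 N →
    ∀ i : Fin (t + 1), ∀ j' : Fin t → ℕ, (∀ k, 1 ≤ j' k ∧ j' k ≤ u) →
      ∑ d ∈ (Finset.Icc 1 ⌊(N : ℝ) ^ (1 - 1 / Real.log (Real.log N) ^ B)⌋₊).filter Squarefree,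
          |(sectionMass Ψ K N u i j' d : ℝ) - sectionDensity Ψ i d * sectionMass Ψ K N u i j' 1|
        ≤ (N : ℝ) / Real.log N ^ A

/-- **The section law** (`SectionLawAt t`, systems of `t + 1` forms; conclusion of `stub_sectionBombieri`):
Bombieri's one-parameter parity law for every coordinate section — for each `(i, j')` ONE `δ ∈ [0,2]` with
`C_{(m,j')} = (1 + (δ-1)(-1)^m) · a_m · (𝔖(Ψ)/𝔖(Ψ₋ᵢ)) · F⁽ⁱ⁾_{j'} + O(N/(log^{t+1}N (log log N)^B))`
for all `m ∈ [1,u]` (`m` odd: `2-δ`, `m` even: `δ`). True in the Hardy–Littlewood world (`δ = 1`); its top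
case `m = u` (`a_u = 0`) is the top-cell smallness the crux silently demands. -/
def SectionLawAt (t : ℕ) : Prop :=
  ∀ (L u B : ℕ), 2 ≤ u → ∃ N₀ : ℕ, ∀ N : ℕ, N₀ ≤ N →
    ∀ Ψ : Fin (t + 1) → AffLinForm 1, IsNondegenerateSystem Ψ → affLinSize Ψ N ≤ L →
    ∀ K : Set (Fin 1 → ℝ), Convex ℝ K → K ⊆ realBox 1 N →
    ∀ i : Fin (t + 1), ∀ j' : Fin t → ℕ, (∀ k, 1 ≤ j' k ∧ j' k ≤ u) →
      ∃ δ : ℝ, 0 ≤ δ ∧ δ ≤ 2 ∧ ∀ m : ℕ, 1 ≤ m → m ≤ u →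
        |(cell Ψ K N u (i.insertNth m j') : ℝ) -
            (1 + (δ - 1) * (-1 : ℝ) ^ m) * modelDensity N u m *
              (singularProduct Ψ / singularProduct (Fin.removeNth i Ψ)) *
                (sectionMass Ψ K N u i j' 1 : ℝ)|
          ≤ (N : ℝ) / (Real.log N ^ (t + 1) * Real.log (Real.log N) ^ B)

/-- **Anatomy of rough integers** (`ModelDensityBounds`; type of `stub_modelDensityBounds`): at fixed `u ≥ 2`,
for large `N`, every model density is `≤ C_u / log N`, the bulk ones `a_m`, `1 ≤ m ≤ u-1`, are `≥ c_u / log N`,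
and `a_m = 0` for `m ≥ u` (a product of `u` primes `> N^{1/u}` exceeds `N`). -/
def ModelDensityBounds : Prop :=
  ∀ u : ℕ, 2 ≤ u → ∃ c C : ℝ, 0 < c ∧ 0 < C ∧ ∃ N₀ : ℕ, ∀ N : ℕ, N₀ ≤ N →
    (∀ m : ℕ, modelDensity N u m ≤ C / Real.log N) ∧
    (∀ m : ℕ, 1 ≤ m → m < u → c / Real.log N ≤ modelDensity N u m) ∧
    (∀ m : ℕ, u ≤ m → modelDensity N u m = 0)

/-- **Singular-series bookkeeping** (`SingularRatioBound`; type of `stub_singularRatio`): for non-degenerate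
`(t+1)`-form systems of size `≤ L` at scale `N`, both singular products are `≥ 0` (limits of non-negative partial
products) and `𝔖(Ψ) ≤ C (log log N)^D 𝔖(Ψ₋ᵢ)` (the Euler-factor ratio exceeds `1` only at the primes dividing
`a_i ∏_{k ≠ i}(a_i b_k - a_k b_i) ≠ 0`, and `n/φ(n) ≪ log log n`). -/
def SingularRatioBound : Prop :=
  ∀ t L : ℕ, ∃ C : ℝ, 0 < C ∧ ∃ D N₀ : ℕ, ∀ N : ℕ, N₀ ≤ N →
    ∀ Ψ : Fin (t + 1) → AffLinForm 1, IsNondegenerateSystem Ψ → affLinSize Ψ N ≤ L →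
    ∀ i : Fin (t + 1),
      0 ≤ singularProduct (Fin.removeNth i Ψ) ∧ 0 ≤ singularProduct Ψ ∧
        singularProduct Ψ ≤ C * Real.log (Real.log N) ^ D * singularProduct (Fin.removeNth i Ψ)

/-- **The Walsh / tensor step** (`WalshStep`; type of `stub_walshStep`): the induction step `t → t + 1` of the
line — given the anatomy bounds and the singular-series bookkeeping, the section law for `(t+1)`-form systems and
the effective law for `t`-form systems imply the effective law for `(t+1)`-form systems (tensor flattening, Walsh
inversion with positivity, the half-body identity `sectionMass … 1 = cell (removeNth i Ψ) (K ∩ {ψ_i > 0})`, the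
identity `archFactor (removeNth i Ψ) (K ∩ {ψ_i > 0}) = archFactor Ψ K`, and `(𝔖/𝔖₋ᵢ)·𝔖₋ᵢ = 𝔖`). -/
def WalshStep : Prop :=
  ModelDensityBounds → SingularRatioBound →
    ∀ t : ℕ, 1 ≤ t → SectionLawAt t → LawEffAt t → LawEffAt (t + 1)

/-- **The composition step** (`ComposeStep`; type of the bookkeeping stub `stub_compose`): atom → engine →
anatomy → bookkeeping → Walsh step → base give the effective law for EVERY number of forms `t ≥ 1`. Pure logic
(induction on `t`); proved below. -/
def ComposeStep : Prop :=
  (∀ t : ℕ, 1 ≤ t → SectionLevelAt t) → (∀ t : ℕ, 1 ≤ t → SectionLevelAt t → SectionLawAt t) →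
    ModelDensityBounds → SingularRatioBound → WalshStep → LawEffAt 1 → ∀ t : ℕ, 1 ≤ t → LawEffAt t

/-! ## The registered bookkeeping stub -/

/-- **`stub_compose`** (registered stub; pure logic): the six stub statements give `LawEffAt t` for every
`t ≥ 1`, by induction on `t` from the base `t = 1` through the Walsh step fed with the engine's section law. -/
theorem stub_compose : ComposeStep := by
  intro hAtom hEngine hDens hSing hStep hBase t ht
  induction t, ht using Nat.le_induction with
  | base => exact hBase
  | succ t ht ih => exact hStep hDens hSing t ht (hEngine t ht (hAtom t ht)) ih

/-! ## Engine vocabulary (skeleton v8, continuation lead `prover-line-stmt-Parity-14109-c1-0`, 2026-08-16)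

The v6 engine stub `stub_sectionBombieri : ∀ t ≥ 1, SectionLevelAt t → SectionLawAt t` is reshaped
(skeleton v8, tree `Cruxes/CellParityLaw/Lines/section_annihilator.lean`) into its pure analytic core —
Bombieri's `P_r` law for the section sequences with Bombieri's OWN density constant
`H_{Ψ,i} = ∏_p (1 - g_{Ψ,i}(p))(1 - 1/p)⁻¹` of the section density (`SectionPrLawAt`, type of the debt
`stub_sectionPrLaw`) — and provable glue: the Euler-ratio identity `H_{Ψ,i} = 𝔖(Ψ)/𝔖(Ψ₋ᵢ)` off local
obstructions, with empty sections on them (`EulerRatioIdentity`, type of `stub_eulerRatio`), the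
conversion `stub_lawOfPrLaw : EulerRatioIdentity → ∀ t ≥ 1, SectionPrLawAt t → SectionLawAt t`, and the
bookkeeping `stub_engineCompose : EngineComposeStep` (pure logic, proved below). As everywhere in this
file NOTHING IS ASSERTED: the `def … : Prop` are statement types of registered stubs. -/

/-- **Bombieri's density constant of the `i`-th section** `H_{Ψ,i} = ∏_p (1 - g_{Ψ,i}(p))(1 - 1/p)⁻¹`
(`g = sectionDensity Ψ i`), as the ordered limit of the partial products over the primes `p ≤ x`
(`limUnder`, junk if divergent; for a non-degenerate system it converges, to `𝔖(Ψ)/𝔖(Ψ₋ᵢ)` when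
`𝔖(Ψ₋ᵢ) ≠ 0` — the content of `EulerRatioIdentity`, from the prime-by-prime telescoping
`(1 - g(p))(1 - 1/p)⁻¹ β_p(Ψ₋ᵢ) = β_p(Ψ)`). This is the constant `H = ∏_p (p/(p-1))(1 - 1/f(p))` of
Bombieri's Theorem ([BombieriRIMS1977] p. 5) for the section sequence, whose density is `1/f = g`. -/
def sectionH {t : ℕ} (Ψ : Fin (t + 1) → AffLinForm 1) (i : Fin (t + 1)) : ℝ :=
  Filter.limUnder Filter.atTop
    (fun x : ℕ => ∏ p ∈ Nat.primesLE x, (1 - sectionDensity Ψ i p) / (1 - (p : ℝ)⁻¹))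

/-- **Bombieri's `P_r` law for the sections** (`SectionPrLawAt t`, systems of `t + 1` forms; conclusion of
the analytic debt `stub_sectionPrLaw : ∀ t ≥ 1, SectionLevelAt t → SectionPrLawAt t`): `SectionLawAt t`
VERBATIM except that the singular-series ratio `𝔖(Ψ)/𝔖(Ψ₋ᵢ)` is replaced by Bombieri's constant
`H_{Ψ,i} = sectionH Ψ i` of the section density — so that the debt is a statement about ONE sifted
sequence `b(m) = #{n ∈ K ∩ ℤ : ψ_i(n) = m, ψ_k(n) ∈ cell j'_k (k ≠ i)}` and its density `g` (level of
distribution in, `Ω`-cell parity law out: Friedlander–Iwaniec, Pisa 1978, §4, made uniform and effective,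
followed by Bombieri's `P_r` Theorem, RIMS 294 (1977) p. 5, made effective), with no reference to
singular series of linear systems. For each `(i, j')` ONE `δ ∈ [0,2]` with
`C_{(m,j')} = (1 + (δ-1)(-1)^m) · a_m · H_{Ψ,i} · F⁽ⁱ⁾_{j'} + O(N/(log^{t+1}N (log log N)^B))` for all
`m ∈ [1,u]`. -/
def SectionPrLawAt (t : ℕ) : Prop :=
  ∀ (L u B : ℕ), 2 ≤ u → ∃ N₀ : ℕ, ∀ N : ℕ, N₀ ≤ N →
    ∀ Ψ : Fin (t + 1) → AffLinForm 1, IsNondegenerateSystem Ψ → affLinSize Ψ N ≤ L →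
    ∀ K : Set (Fin 1 → ℝ), Convex ℝ K → K ⊆ realBox 1 N →
    ∀ i : Fin (t + 1), ∀ j' : Fin t → ℕ, (∀ k, 1 ≤ j' k ∧ j' k ≤ u) →
      ∃ δ : ℝ, 0 ≤ δ ∧ δ ≤ 2 ∧ ∀ m : ℕ, 1 ≤ m → m ≤ u →
        |(cell Ψ K N u (i.insertNth m j') : ℝ) -
            (1 + (δ - 1) * (-1 : ℝ) ^ m) * modelDensity N u m * sectionH Ψ i *
                (sectionMass Ψ K N u i j' 1 : ℝ)|
          ≤ (N : ℝ) / (Real.log N ^ (t + 1) * Real.log (Real.log N) ^ B)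

/-- **The Euler-ratio identity** (`EulerRatioIdentity`; type of `stub_eulerRatio`): for non-degenerate
`(t+1)`-form systems of size `≤ L` at scale `N ≥ N₀(t, L, u)` and every coordinate `i`: if the sub-system
`Ψ₋ᵢ` has no local obstruction, `𝔖(Ψ₋ᵢ) ≠ 0`, then Bombieri's constant of the section density IS the
singular-series ratio, `H_{Ψ,i} = 𝔖(Ψ)/𝔖(Ψ₋ᵢ)` (prime by prime `(1 - g(p))(1 - 1/p)⁻¹ β_p(Ψ₋ᵢ) = β_p(Ψ)`
from `localFactor_prime`, then the limits of Green–Tao 2010, Lemma 1.3); and if `𝔖(Ψ₋ᵢ) = 0`, then `Ψ₋ᵢ`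
has a local obstruction at a prime `p ≤ max(t, L)` (Green–Tao, remark after Lemma 1.3; the tree's
`singularProduct_pos_of_localFactor_pos`, `le_goodCount_add`), every lattice point has a frozen form
divisible by `p < N^{1/u}`, and every section mass vanishes. -/
def EulerRatioIdentity : Prop :=
  ∀ (t L u : ℕ), 2 ≤ u → ∃ N₀ : ℕ, ∀ N : ℕ, N₀ ≤ N →
    ∀ Ψ : Fin (t + 1) → AffLinForm 1, IsNondegenerateSystem Ψ → affLinSize Ψ N ≤ L →
    ∀ i : Fin (t + 1),
      (singularProduct (Fin.removeNth i Ψ) ≠ 0 →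
          sectionH Ψ i = singularProduct Ψ / singularProduct (Fin.removeNth i Ψ)) ∧
      (singularProduct (Fin.removeNth i Ψ) = 0 →
          ∀ (K : Set (Fin 1 → ℝ)) (j' : Fin t → ℕ), sectionMass Ψ K N u i j' 1 = 0)

/-- **The engine composition step** (`EngineComposeStep`; type of the bookkeeping stub
`stub_engineCompose`): the Euler-ratio identity, the analytic debt and the conversion give the v6 engine
`∀ t ≥ 1, SectionLevelAt t → SectionLawAt t` consumed by `cellParityLaw_of_atom_of_engine`. Pure logic. -/
def EngineComposeStep : Prop :=
  EulerRatioIdentity →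
    (∀ t : ℕ, 1 ≤ t → SectionLevelAt t → SectionPrLawAt t) →
      (EulerRatioIdentity → ∀ t : ℕ, 1 ≤ t → SectionPrLawAt t → SectionLawAt t) →
        ∀ t : ℕ, 1 ≤ t → SectionLevelAt t → SectionLawAt t

/-- **`stub_engineCompose`** (registered bookkeeping stub of skeleton v8; pure logic): conversion after debt
after atom, with the Euler-ratio identity supplied to the conversion. -/
theorem stub_engineCompose : EngineComposeStep :=
  fun hE hPr hLaw t ht hA => hLaw hE t ht (hPr t ht hA)

end Summit.Parity.GeneralizedHardyLittlewood.Cruxes.CellParityLaw.SectionAnnihilator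

end
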